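import Mathlib
import Literature.Analysis.FluidPDE.LinearizedNSTorus
import Literature.Analysis.FluidPDE.SteadyNSLatticePersistenceDrift
import Literature.Analysis.FunctionSpaces.TorusFourierModes
import HarnessLib

/-!
# Stub `stub_galerkinShadowingGlue` of crux `WindLine.WindyGalerkinSteadyZerothLaw`
# (stmt-AnomalousDissipation-11414), line `registered`

The lead's GLUE stub: Galerkin shadowing of a leaf-nondegenerate classical steady state of
`NS_ν(f)` by windy Galerkin steady states, from the five neighbour stubs taken as hypotheses
(abstract Galerkin–Newton–Kantorovich lemma, Fourier truncations on the lattice state space `W`,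
injectivity of the leaf linearisation, tested Galerkin equations from the punctured-ball lattice
equations, energy/enstrophy along an `H¹`-convergent sequence). The proof runs in the
conserved-momentum leaf on the Fourier lattice exactly as
`Literature.Analysis.FluidPDE.SteadyLatticeDrift.steadyPersistsInLeaf_of_nondeg` (§1–§4, §7–§8 there),
with the force element `F(k) = Π_k f̂(k)` and the Galerkin zeros in place of local inversion.
-/

noncomputable section

-- D-0017: single-problem summit ⇒ the duplicated namespace segment is by design.
set_option linter.dupNamespace false

open scoped InnerProductSpace Topology ComplexConjugate
open MeasureTheory Filter UnitAddTorus
open Literature.Analysis.FunctionSpaces Literature.Analysis.FunctionSpaces.Torus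
open Literature.Analysis.FunctionSpaces.EuclideanSpace
open Literature.Analysis.FluidPDE Literature.Analysis.FluidPDE.Torus
open Literature.Analysis.FluidPDE.ScalarFourier
open Literature.Analysis.FluidPDE.SteadyLattice Literature.Analysis.FluidPDE.SteadyLatticeDrift

namespace Summit.AnomalousDissipation.AnomalousDissipation.Theorems.WindLineWindyGalerkinSteadyZerothLaw

/-- The flat three-torus (local notation). -/
local notation "𝕋³" => UnitAddTorus (Fin 3)
/-- Velocity values (local notation). -/
local notation "E³" => EuclideanSpace ℝ (Fin 3)
/-- Complex coefficient vectors (local notation). -/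
local notation "ℂ³" => EuclideanSpace ℂ (Fin 3)
/-- Square-summable coefficient families `ℤ³ → ℂ³` (local notation). -/
local notation "ℓ2" => lp (fun _ : Fin 3 → ℤ => EuclideanSpace ℂ (Fin 3)) 2
/-- Physical coefficients `x̌(k) = x(k)/|k|²` of a family (local notation, the tree's `cf`). -/
local notation "cf[" X "]" => ((fun mm : Fin 3 → ℤ => (((freqNormSq mm)⁻¹ : ℝ) : ℂ)) • (X : (Fin 3 → ℤ) → EuclideanSpace ℂ (Fin 3)))
/-- `k · v = ∑ⱼ kⱼ vⱼ` (local notation, the tree's `kdot`). -/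
local notation "kdot[" k "," v "]" => (∑ jj : Fin 3, (((k : Fin 3 → ℤ) jj : ℤ) : ℂ) * (v : EuclideanSpace ℂ (Fin 3)) jj)
/-- The convective symbol `N(a, b)(k)` as a vector of `ℂ³` (local notation, the tree's `nl`). -/
local notation "nl[" a "," b "," k "]" =>
  ((WithLp.toLp 2 (fun pp : Fin 3 => transportSym (fun jj mm => (a : (Fin 3 → ℤ) → EuclideanSpace ℂ (Fin 3)) mm jj)
    (fun mm => (b : (Fin 3 → ℤ) → EuclideanSpace ℂ (Fin 3)) mm pp) k)) : EuclideanSpace ℂ (Fin 3))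

/-- **The force element**: for a smooth force `f`, the Leray-projected coefficient family
`k ↦ Π_k f̂(k)` is rapidly decaying, has zero mode `0`, is transversal and conjugate symmetric. -/
theorem forceFamily_spec {f : 𝕋³ → E³} (hf : IsSmooth f) :
    RapidDecay (fun k : Fin 3 → ℤ => lerayCoeff k (mFourierCoeff (complexify ∘ f) k)) ∧
      (fun k : Fin 3 → ℤ => lerayCoeff k (mFourierCoeff (complexify ∘ f) k)) 0 = 0 ∧
      (∀ kk : Fin 3 → ℤ, kdot[kk, (fun k : Fin 3 → ℤ => lerayCoeff k (mFourierCoeff (complexify ∘ f) k)) kk] = 0) ∧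
      IsConjSymm (fun k : Fin 3 → ℤ => lerayCoeff k (mFourierCoeff (complexify ∘ f) k)) := by
  refine ⟨?_, ?_, fun k => kdot_lerayCoeff k _, fun k => ?_⟩
  · exact (hf.complexify_comp.rapidDecay_mFourierCoeff).of_norm_le_mul (C := 1) fun k => by
      rw [one_mul]; exact norm_lerayCoeff_le k _
  · exact Torus.lerayCoeff_zero _
  · have hcs : IsConjSymm (mFourierCoeff (complexify ∘ f)) := isConjSymm_mFourierCoeff hf.integrable
    dsimp only
    rw [hcs k, lerayCoeff_neg_conjVec]

set_option maxHeartbeats 400000 in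
/-- **Stub `stub_galerkinShadowingGlue` (the lead's GLUE)**: Galerkin shadowing of a leaf-nondegenerate
classical steady state from the five neighbour stubs (abstract Galerkin lemma `hA`, truncations on `W`
`hP`, injective linearisation `hI`, tested-of-lattice `hT`, `H¹`-limit norms `hL`), run in the
conserved-momentum leaf on the Fourier lattice (pattern of
`SteadyLatticeDrift.steadyPersistsInLeaf_of_nondeg`). -/
theorem stub_galerkinShadowingGlue :
    (∀ {E : Type} [NormedAddCommGroup E] [NormedSpace ℝ E] [CompleteSpace E]
      (c : ℝ) (D K : E →L[ℝ] E) (B : E → E → E) (x₀ F : E) (P : ℕ → E →L[ℝ] E),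
      c ≠ 0 → IsBoundedBilinearMap ℝ (fun p : E × E => B p.1 p.2) →
      (∀ w, K w = B x₀ w + B w x₀) → IsCompactOperator (D + K) →
      (∀ w, c • w + (D + K) w = 0 → w = 0) →
      c • x₀ + D x₀ + B x₀ x₀ = F →
      (∀ N x, P N (P N x) = P N x) → (∀ N x, ‖P N x‖ ≤ ‖x‖) →
      (∀ x, Tendsto (fun N => P N x) atTop (𝓝 x)) →
      ∃ x : ℕ → E, (∀ᶠ N in atTop, P N (x N) = x N ∧ P N (c • x N + D (x N) + B (x N) (x N)) = P N F) ∧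
        Tendsto x atTop (𝓝 x₀)) →
    (∀ (W : Submodule ℝ ℓ2),
      (∀ x : ℓ2, x ∈ W ↔ ((x : (Fin 3 → ℤ) → ℂ³) 0 = 0 ∧ (∀ kk : Fin 3 → ℤ, kdot[kk, (x : (Fin 3 → ℤ) → ℂ³) kk] = 0) ∧
        IsConjSymm (x : (Fin 3 → ℤ) → ℂ³))) →
      IsClosed (W : Set ℓ2) →
      ∃ P : ℕ → W →L[ℝ] W,
        (∀ (N : ℕ) (x : W) (k : Fin 3 → ℤ),
          (((P N x : W) : ℓ2) : (Fin 3 → ℤ) → ℂ³) k = if k ∈ freqBall N then ((x : ℓ2) : (Fin 3 → ℤ) → ℂ³) k else 0) ∧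
        (∀ N x, P N (P N x) = P N x) ∧ (∀ N x, ‖P N x‖ ≤ ‖x‖) ∧
        (∀ x, Tendsto (fun N => P N x) atTop (𝓝 x))) →
    (∀ (W : Submodule ℝ ℓ2)
      (_hW : ∀ x : ℓ2, x ∈ W ↔ ((x : (Fin 3 → ℤ) → ℂ³) 0 = 0 ∧
        (∀ kk : Fin 3 → ℤ, kdot[kk, (x : (Fin 3 → ℤ) → ℂ³) kk] = 0) ∧ IsConjSymm (x : (Fin 3 → ℤ) → ℂ³)))
      (B : W → W → W)
      (_hB : ∀ x y : W, (((B x y : W) : ℓ2) : (Fin 3 → ℤ) → ℂ³) = fun k =>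
        lerayCoeff k nl[cf[((x : ℓ2) : (Fin 3 → ℤ) → ℂ³)], cf[((y : ℓ2) : (Fin 3 → ℤ) → ℂ³)], k])
      (ν : ℝ) (u : 𝕋³ → E³) (D K : W →L[ℝ] W) (x₀ : W),
      0 < ν → IsSmooth u → IsDivFree u → ¬ IsLinNSEigenvalue ν u 0 →
      (∀ x : W, (((D x : W) : ℓ2) : (Fin 3 → ℤ) → ℂ³) = fun k =>
        (2 * Real.pi * Complex.I * kdot[k, mFourierCoeff (complexify ∘ u) 0]) • cf[((x : ℓ2) : (Fin 3 → ℤ) → ℂ³)] k) →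
      (∀ w, K w = B x₀ w + B w x₀) →
      cf[((x₀ : ℓ2) : (Fin 3 → ℤ) → ℂ³)] = Function.update (mFourierCoeff (complexify ∘ u)) 0 0 →
      ∀ w : W, (4 * Real.pi ^ 2 * ν) • w + (D + K) w = 0 → w = 0) →
    (∀ (ν : ℝ) (N : ℕ) (f U : 𝕋³ → E³), IsSmooth f → IsSmooth U → IsDivFree U →
      (∀ k ∈ (freqBall N).erase (0 : Fin 3 → ℤ),
        (((ν * (4 * Real.pi ^ 2 * freqNormSq k)) : ℝ) : ℂ) • mFourierCoeff (complexify ∘ U) k +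
          lerayCoeff k nl[mFourierCoeff (complexify ∘ U), mFourierCoeff (complexify ∘ U), k] =
        lerayCoeff k (mFourierCoeff (complexify ∘ f) k)) →
      ∀ a : 𝕋³ → E³, IsSmooth a → IsDivFree a →
        (∀ k ∉ (freqBall N).erase (0 : Fin 3 → ℤ), mFourierCoeff (complexify ∘ a) k = 0) →
        ∫ x, (⟪U x, convect U a x⟫_ℝ + ν * ⟪U x, laplacian a x⟫_ℝ + ⟪f x, a x⟫_ℝ) = 0) →
    (∀ (u : 𝕋³ → E³) (U : ℕ → 𝕋³ → E³), IsSmooth u → (∀ N, IsSmooth (U N)) →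
      Tendsto (fun N => (∫ x, ‖U N x - u x‖ ^ 2) + gradNormSq (fun x => U N x - u x)) atTop (𝓝 0) →
      Tendsto (fun N => ∫ x, ‖U N x‖ ^ 2) atTop (𝓝 (∫ x, ‖u x‖ ^ 2)) ∧
        Tendsto (fun N => gradNormSq (U N)) atTop (𝓝 (gradNormSq u))) →
    ∀ (ν : ℝ) (f u : 𝕋³ → E³) (p : 𝕋³ → ℝ), 0 < ν → IsSmooth f → IsDivFree f → HasZeroMean f →
      IsSteadyNSState ν f u p → ¬ IsLinNSEigenvalue ν u 0 →
        ∃ U : ℕ → 𝕋³ → E³,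
          (∀ᶠ N in atTop, IsSmooth (U N) ∧ IsDivFree (U N) ∧
            (∀ k ∉ freqBall N, mFourierCoeff (EuclideanSpace.complexify ∘ U N) k = 0) ∧
            ∀ a : 𝕋³ → E³, IsSmooth a → IsDivFree a →
              (∀ k ∉ (freqBall N).erase (0 : Fin 3 → ℤ), mFourierCoeff (EuclideanSpace.complexify ∘ a) k = 0) →
              ∫ x, (⟪U N x, convect (U N) a x⟫_ℝ + ν * ⟪U N x, laplacian a x⟫_ℝ + ⟪f x, a x⟫_ℝ) = 0) ∧
          Tendsto (fun N => ∫ x, ‖U N x‖ ^ 2) atTop (𝓝 (∫ x, ‖u x‖ ^ 2)) ∧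
          Tendsto (fun N => gradNormSq (U N)) atTop (𝓝 (gradNormSq u)) := by
  intro hA hP hI hT hL ν f u p hν hf _hfd _hf0 hst hnd
  -- §1 the unperturbed state on the Fourier side (full family, zero mode = the mean)
  have hu : IsSmooth u := hst.smooth_velocity.isSmooth_slice (Set.mem_univ 0)
  have hdiv : IsDivFree u := hst.divFree 0 (Set.mem_univ 0)
  set a : (Fin 3 → ℤ) → ℂ³ := mFourierCoeff (complexify ∘ u) with ha
  have har : RapidDecay a := hu.complexify_comp.rapidDecay_mFourierCoeff
  have hat : ∀ m : Fin 3 → ℤ, kdot[m, a m] = 0 := fun m => hdiv.sum_mul_mFourierCoeff_eq_zero hu m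
  have hacs : IsConjSymm a := isConjSymm_mFourierCoeff hu.integrable
  have hM : conjVec (a 0) = a 0 := by
    have h := hacs 0
    rw [neg_zero] at h
    exact h.symm
  have hbr : RapidDecay (Function.update a 0 0) := rapidDecay_update har
  have heq₀ := fun k => fourier_eq_drift_of_isSteadyNSState hst hf k
  -- §2 the state space, the bilinear map, the drift, the truncations
  obtain ⟨W, hW, hWc⟩ := exists_space
  haveI : CompleteSpace W := completeSpace_W hWc
  obtain ⟨B, hB, hBb⟩ := exists_bilinear hW
  obtain ⟨D, hD, hDc⟩ := exists_drift hW hWc hM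
  obtain ⟨P, hPcoord, hPidem, hPnorm, hPconv⟩ := hP W hW hWc
  -- §3 the base point `x₀` (its physical coefficients are the punctured family `a°`)
  set X₀ : (Fin 3 → ℤ) → ℂ³ := fun k => ((freqNormSq k : ℝ) : ℂ) • a k with hX₀
  have hX₀r : RapidDecay X₀ := by
    refine har.of_norm_le_mul_pow (C := 1) (s := 1) fun k => ?_
    rw [hX₀]
    dsimp only
    rw [norm_smul, Complex.norm_real, Real.norm_of_nonneg (freqNormSq_nonneg k), one_mul, pow_one]
    exact mul_le_mul_of_nonneg_right (by linarith [freqNormSq_nonneg k]) (norm_nonneg _)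
  have hX00 : X₀ 0 = 0 := by simp [hX₀, freqNormSq_zero]
  have hX₀V : ((X₀ : (Fin 3 → ℤ) → ℂ³) 0 = 0 ∧ (∀ kk : Fin 3 → ℤ, kdot[kk, (X₀ : (Fin 3 → ℤ) → ℂ³) kk] = 0) ∧
      IsConjSymm (X₀ : (Fin 3 → ℤ) → ℂ³)) := by
    refine ⟨hX00, fun k => by rw [hX₀]; dsimp only; rw [kdot_smul, hat k, mul_zero], fun k => ?_⟩
    rw [hX₀]
    dsimp only
    rw [freqNormSq_neg, hacs k, conjVec_smul, Complex.conj_ofReal]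
  obtain ⟨x₀, hx₀⟩ : ∃ x₀ : W, (((x₀ : W) : ℓ2) : (Fin 3 → ℤ) → ℂ³) = X₀ :=
    ⟨⟨⟨X₀, memℓp_two_of_rapidDecay hX₀r⟩, (hW _).2 hX₀V⟩, rfl⟩
  have hcfX : cf[X₀] = Function.update a 0 0 := by rw [hX₀]; exact cf_weight_smul' a
  have hcf : cf[(((x₀ : W) : ℓ2) : (Fin 3 → ℤ) → ℂ³)] = Function.update a 0 0 := by rw [hx₀]; exact hcfX
  -- §3' the force element `F ∈ W`, `F(k) = Π_k f̂(k)`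
  obtain ⟨hFr, hFV⟩ := forceFamily_spec hf
  obtain ⟨F, hFcoe⟩ : ∃ F : W, (((F : W) : ℓ2) : (Fin 3 → ℤ) → ℂ³) =
      fun k => lerayCoeff k (mFourierCoeff (complexify ∘ f) k) :=
    ⟨⟨⟨_, memℓp_two_of_rapidDecay hFr⟩, (hW _).2 hFV⟩, rfl⟩
  -- §4 the drifted steady map: derivative, compactness, injectivity, value at the base point
  set cν : ℝ := 4 * Real.pi ^ 2 * ν
  have hcν0 : cν ≠ 0 := by positivity
  obtain ⟨K, hKw⟩ : ∃ K : W →L[ℝ] W, ∀ w, K w = B x₀ w + B w x₀ :=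
    ⟨(hBb.deriv (x₀, x₀)).comp ((ContinuousLinearMap.id ℝ W).prod (ContinuousLinearMap.id ℝ W)),
      fun w => by simp [IsBoundedBilinearMap.deriv_apply]⟩
  have hKc : IsCompactOperator K := isCompactOperator_linearised hWc hB x₀ (by rw [hcf]; exact hbr) K hKw
  have hDKc : IsCompactOperator ((D + K : W →L[ℝ] W) : W → W) := by
    have h := hDc.add hKc
    rwa [← FunLike.coe_add] at h
  have hinj : ∀ w : W, cν • w + (D + K : W →L[ℝ] W) w = 0 → w = 0 :=
    hI W hW B hB ν u D K x₀ hν hu hdiv hnd hD hKw hcf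
  have hGx₀ : cν • x₀ + D x₀ + B x₀ x₀ = F := by
    refine Subtype.ext (lp.ext (funext fun k => ?_))
    rw [coeW_add, coeW_add, coeW_smul, hB, hD, hFcoe, hx₀]
    simp only [Pi.add_apply, Pi.smul_apply]
    rw [← Complex.coe_smul, smul_eq_weight_smul_cf hX00 k, hcfX, ← heq₀ k]
  -- §6' Galerkin zeros `x N → x₀` (abstract Galerkin–Newton–Kantorovich lemma on `E := W`)
  obtain ⟨x, hxev, hxlim⟩ := hA cν D K B x₀ F P hcν0 hBb hKw hDKc hinj hGx₀ hPidem hPnorm hPconv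
  -- §7' the Galerkin fields: full families `c₁ N = cf (x N) + δ₀ a(0)` synthesised on the frequency ball
  obtain ⟨c₁, hc₁⟩ : ∃ c₁ : ℕ → (Fin 3 → ℤ) → ℂ³, ∀ N, c₁ N = cf[(((x N : W) : ℓ2) : (Fin 3 → ℤ) → ℂ³)] +
      (Pi.single (0 : Fin 3 → ℤ) (a 0) : (Fin 3 → ℤ) → ℂ³) :=
    ⟨fun N => cf[(((x N : W) : ℓ2) : (Fin 3 → ℤ) → ℂ³)] + (Pi.single (0 : Fin 3 → ℤ) (a 0) : (Fin 3 → ℤ) → ℂ³),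
      fun N => rfl⟩
  have hS : ∀ N : ℕ, ∀ k ∈ (freqBall N : Finset (Fin 3 → ℤ)), -k ∈ (freqBall N : Finset (Fin 3 → ℤ)) :=
    fun N k hk => neg_mem_freqBall.2 hk
  have hcs : ∀ N, IsConjSymm (c₁ N) := fun N => by
    rw [hc₁ N]; exact (isConjSymm_cf (W_conj hW (x N))).add (isConjSymm_single hM)
  have hct : ∀ (N : ℕ) (k : Fin 3 → ℤ), kdot[k, c₁ N k] = 0 := fun N k => by
    rw [hc₁ N, Pi.add_apply, kdot_add, cf_transversal (W_trans hW (x N)) k, single_transversal, add_zero]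
  obtain ⟨U, hU⟩ : ∃ U : ℕ → 𝕋³ → E³, ∀ N, U N = realTrigPoly (freqBall N) (c₁ N) :=
    ⟨fun N => realTrigPoly (freqBall N) (c₁ N), fun N => rfl⟩
  have hUs : ∀ N, IsSmooth (U N) := fun N => by rw [hU N]; exact isSmooth_realTrigPoly _ _
  have hUd : ∀ N, IsDivFree (U N) := fun N => by rw [hU N]; exact isDivFree_realTrigPoly fun k _ => hct N k
  have hUb : ∀ N, ∀ k ∉ freqBall N, mFourierCoeff (complexify ∘ U N) k = 0 := fun N k hk => by
    rw [hU N]; exact mFourierCoeff_realTrigPoly_eq_zero (hS N) (hcs N) hk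
  -- on the Galerkin range the Fourier family of `U N` is the full family `c₁ N`
  have hcoefU : ∀ N, P N (x N) = x N → mFourierCoeff (complexify ∘ U N) = c₁ N := by
    intro N hPN
    funext k
    rw [hU N, mFourierCoeff_realTrigPoly (hS N) (hcs N) k]
    by_cases hk : k ∈ freqBall N
    · rw [if_pos hk]
    · rw [if_neg hk]
      have hk0 : k ≠ 0 := fun h => hk (h ▸ zero_mem_freqBall N)
      have hxk : (((x N : W) : ℓ2) : (Fin 3 → ℤ) → ℂ³) k = 0 := by
        have h := hPcoord N (x N) k
        rw [hPN, if_neg hk] at h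
        exact h
      rw [hc₁ N, Pi.add_apply, Pi.single_eq_of_ne hk0, add_zero, cf_apply, hxk, smul_zero]
  -- the Galerkin equations are the projected steady lattice equations on the punctured ball
  have hlat : ∀ N, P N (x N) = x N → P N (cν • x N + D (x N) + B (x N) (x N)) = P N F →
      ∀ k ∈ (freqBall N).erase (0 : Fin 3 → ℤ),
        (((ν * (4 * Real.pi ^ 2 * freqNormSq k)) : ℝ) : ℂ) • mFourierCoeff (complexify ∘ U N) k +
          lerayCoeff k nl[mFourierCoeff (complexify ∘ U N), mFourierCoeff (complexify ∘ U N), k] =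
        lerayCoeff k (mFourierCoeff (complexify ∘ f) k) := by
    intro N hPN hGN k hk
    have hkb : k ∈ freqBall N := Finset.mem_of_mem_erase hk
    -- the Galerkin coordinate identity at `k`
    have hxeq := congrArg (fun z : W => (((z : W) : ℓ2) : (Fin 3 → ℤ) → ℂ³) k) hGN
    dsimp only at hxeq
    rw [hPcoord, hPcoord, if_pos hkb, if_pos hkb, coeW_add, coeW_add, coeW_smul, hB, hD, hFcoe] at hxeq
    simp only [Pi.add_apply, Pi.smul_apply] at hxeq
    rw [← Complex.coe_smul, smul_eq_weight_smul_cf (W_zero hW (x N)) k] at hxeq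
    -- conversion to the full family (zero mode restored, drift absorbed into `N(c₁, c₁)`)
    have hcoef := hcoefU N hPN
    have hc₁r : RapidDecay (c₁ N) := by rw [← hcoef]; exact (hUs N).complexify_comp.rapidDecay_mFourierCoeff
    have hupd : Function.update (c₁ N) 0 0 = cf[(((x N : W) : ℓ2) : (Fin 3 → ℤ) → ℂ³)] := by
      rw [hc₁ N]; exact update_add_single_of_zero (cf_zero _) _
    have hc₁0 : c₁ N 0 = a 0 := by rw [hc₁ N]; exact add_single_apply_zero (cf_zero _) _
    rw [hcoef, leray_nl_self_update hc₁r (hct N) k, ← weight_smul_update (c₁ N) k, hupd, hc₁0, ← hxeq]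
    abel
  -- §8' the `H¹` distance to `u` is controlled by `‖x N - x₀‖` (Parseval), hence tends to zero
  have hH1 : ∀ N, P N (x N) = x N →
      (∫ y, ‖U N y - u y‖ ^ 2) + gradNormSq (fun y => U N y - u y) ≤ (1 + 4 * Real.pi ^ 2) * ‖x N - x₀‖ ^ 2 := by
    intro N hPN
    have hv : IsSmooth (fun y => U N y - u y) := (hUs N).sub hu
    have hcoefv : mFourierCoeff (complexify ∘ fun y => U N y - u y) =
        cf[(((x N - x₀ : W) : ℓ2) : (Fin 3 → ℤ) → ℂ³)] := by
      have e : (complexify ∘ fun y => U N y - u y : 𝕋³ → ℂ³) = (complexify ∘ U N) - (complexify ∘ u) := by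
        funext y; simp
      rw [e, coeW_sub]
      funext k
      rw [mFourierCoeff_sub (hUs N).complexify_comp.integrable hu.complexify_comp.integrable, hcoefU N hPN, ← ha]
      have hak : a k = Function.update a 0 0 k + (Pi.single (0 : Fin 3 → ℤ) (a 0) : (Fin 3 → ℤ) → ℂ³) k :=
        (congrFun (update_add_single a) k).symm
      rw [hak, ← hcf, hc₁ N]
      simp only [Pi.add_apply, Pi.smul_apply', Pi.sub_apply, smul_sub]
      abel
    have h := h1_le_of_coeff hv ((x N - x₀ : W) : ℓ2) hcoefv
    rwa [norm_coeW] at h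
  have hlim0 : Tendsto (fun N => (1 + 4 * Real.pi ^ 2) * ‖x N - x₀‖ ^ 2) atTop (𝓝 0) := by
    have h := ((tendsto_iff_norm_sub_tendsto_zero.1 hxlim).pow 2).const_mul (1 + 4 * Real.pi ^ 2)
    rw [zero_pow two_ne_zero, mul_zero] at h
    exact h
  have hH1lim : Tendsto (fun N => (∫ y, ‖U N y - u y‖ ^ 2) + gradNormSq (fun y => U N y - u y)) atTop (𝓝 0) :=
    tendsto_of_tendsto_of_tendsto_of_le_of_le' tendsto_const_nhds hlim0
      (Eventually.of_forall fun N => add_nonneg (integral_nonneg fun _ => sq_nonneg _) (gradNormSq_nonneg _))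
      (hxev.mono fun N hN => hH1 N hN.1)
  obtain ⟨hl₁, hl₂⟩ := hL u U hu hUs hH1lim
  exact ⟨U, hxev.mono fun N hN => ⟨hUs N, hUd N, hUb N, hT ν N f (U N) hf (hUs N) (hUd N) (hlat N hN.1 hN.2)⟩,
    hl₁, hl₂⟩

end Summit.AnomalousDissipation.AnomalousDissipation.Theorems.WindLineWindyGalerkinSteadyZerothLaw

end
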